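import Mathlib
import Summits.Ventures.HodgeRepro2.Tier7.Target
import Summits.Ventures.HodgeRepro2.Tier7.Common.Shadow
import Summits.Ventures.HodgeRepro2.Tier7.Common.Hecke

/-!
# Tier7/Common/OrthProj — the `L²`-orthogonal projection onto a finite-dimensional subspace of
`H^{1,0} ∧ H^{1,0}` (t7-typer-1; the shared API asked for by the t7-lead, STATUS l. 14635 (2))

Cell pub-hodge-repro2, Tier 7 (README §11–§12), seat t7-typer-1 (sole filer of `Tier7/Common/**`).
Proof lane: everything below is PROVED from the fields of `SurfaceShadow HX G` as frozen in
`Tier7/Target.lean`; no new carrier, no new field, no axiom, no `sorry`. Nothing here asserts the step.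

CONTENT. For `W ≤ H^{1,0} ∧ H^{1,0}` finite-dimensional, the pairing `⟨·,·⟩ = L2` is a positive-definite
hermitian form on `W` (`hr_pos`, `comm_H20` + `intX_bar`), so `W` is a finite-dimensional complex inner product
space (`wCore`, Mathlib convention `⟪x, y⟫ = L2 y x`) and Riesz representation gives, for every `a ∈ H^*(X_∞)`,
a unique `orthProj a ∈ W` with `L2 x (orthProj a) = L2 x a` for all `x ∈ W`. `orthProj S hW : HX →ₗ[ℂ] HX` is
ℂ-linear, the identity on `W`, zero exactly on the `L²`-orthogonal of `W`, and `G`-equivariant when `W` is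
Hecke-stable (`orthProj_act`, from `L2_act`). THE CONSUMER THEOREM `exists_irred_equivariant_map`: two
Hecke-stable subspaces `U, U' ≤ H^{1,0} ∧ H^{1,0}` containing a non-orthogonal pair (`a ∈ U`, `b ∈ U'`,
`L2 a b ≠ 0`), with `U'` finite-dimensional, contain Hecke-irreducible `W ≤ U`, `W' ≤ U'` and a NON-ZERO
`G`-equivariant ℂ-linear map `W → W'` (the `L²`-projection onto `W'` restricted to `W`) — the shape of L1's
`CommonIrred` and of the finite-dimensional converses of L1-p5 / L3-p1, stated here without any Line name.

§8(d): uses an L-value-free non-vanishing device: NO (general lemmas over the carriers).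
-/

namespace Summit.Ventures.HodgeRepro2.Tier7

noncomputable section

namespace SurfaceShadow

variable {HX : Type} [Ring HX] [Algebra ℂ HX] {G : Type} [Group G] [MulAction G HX]

/-! ### 1. `W` as an inner product space -/

/-- `L2 a (b - c) = L2 a b - L2 a c`. -/
theorem L2_sub_right (S : SurfaceShadow HX G) (a b c : HX) : S.L2 a (b - c) = S.L2 a b - S.L2 a c := by
  simp only [sub_eq_add_neg, S.L2_add_right, S.L2_neg_right]

/-- `L2 (a - b) c = L2 a c - L2 b c`. -/
theorem L2_sub_left (S : SurfaceShadow HX G) (a b c : HX) : S.L2 (a - b) c = S.L2 a c - S.L2 b c := by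
  simp only [sub_eq_add_neg, S.L2_add_left, S.L2_neg_left]

/-- Two vectors of `W ≤ H^{1,0} ∧ H^{1,0}` with the same pairings against every vector of `W` coincide
(non-degeneracy of the positive-definite pairing). -/
theorem eq_of_L2_eq_on (S : SurfaceShadow HX G) {W : Submodule ℂ HX} (hW : W ≤ S.H10 * S.H10)
    {p q : HX} (hp : p ∈ W) (hq : q ∈ W) (h : ∀ x ∈ W, S.L2 x p = S.L2 x q) : p = q := by
  have hpq : p - q ∈ W := W.sub_mem hp hq
  have h0 : S.L2 (p - q) (p - q) = 0 := by
    rw [S.L2_sub_right, h _ hpq, sub_self]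
  exact sub_eq_zero.mp ((S.L2_self_eq_zero_iff (hW hpq)).mp h0)

/-- The Hodge inner product on `W ≤ H^{1,0} ∧ H^{1,0}`, in Mathlib's convention `⟪x, y⟫ = L2 y x`
(conjugate-linear in the first slot). -/
abbrev wCore (S : SurfaceShadow HX G) {W : Submodule ℂ HX} (hW : W ≤ S.H10 * S.H10) :
    InnerProductSpace.Core ℂ W where
  inner x y := S.L2 (y : HX) (x : HX)
  conj_inner_symm x y := (S.L2_conj_symm (hW x.2) (hW y.2)).symm
  re_inner_nonneg x := by
    by_cases hx : (x : HX) = 0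
    · simp [hx, S.L2_zero_left]
    · exact le_of_lt (S.L2_self_re_pos (hW x.2) hx)
  add_left x y z := by
    show S.L2 (z : HX) ((x : HX) + (y : HX)) = S.L2 (z : HX) (x : HX) + S.L2 (z : HX) (y : HX)
    exact S.L2_add_right _ _ _
  smul_left x y r := by
    show S.L2 (y : HX) (r • (x : HX)) = (starRingEnd ℂ) r * S.L2 (y : HX) (x : HX)
    exact S.L2_smul_right r _ _
  definite x hx := Subtype.ext ((S.L2_self_eq_zero_iff (hW x.2)).mp hx)

/-- The normed group structure of `W` induced by the Hodge inner product. -/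
abbrev wNormed (S : SurfaceShadow HX G) {W : Submodule ℂ HX} (hW : W ≤ S.H10 * S.H10) :
    NormedAddCommGroup W :=
  @InnerProductSpace.Core.toNormedAddCommGroup ℂ W _ _ _ (S.wCore hW)

/-- The inner product space structure of `W` induced by the Hodge inner product. -/
abbrev wInner (S : SurfaceShadow HX G) {W : Submodule ℂ HX} (hW : W ≤ S.H10 * S.H10) :
    @InnerProductSpace ℂ W _ (S.wNormed hW).toSeminormedAddCommGroup :=
  InnerProductSpace.ofCore _

/-! ### 2. The orthogonal projection -/

/-- The `L²`-orthogonal projection of `a ∈ H^*(X_∞)` onto the finite-dimensional `W ≤ H^{1,0} ∧ H^{1,0}`: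
the Riesz representative in `W` of the linear functional `x ↦ L2 x a`. -/
def orthProjFun (S : SurfaceShadow HX G) {W : Submodule ℂ HX} (hW : W ≤ S.H10 * S.H10)
    [FiniteDimensional ℂ W] (a : HX) : HX :=
  letI := S.wNormed hW
  letI := S.wInner hW
  letI : CompleteSpace W := FiniteDimensional.complete ℂ W
  ((InnerProductSpace.toDual ℂ W).symm
    (LinearMap.toContinuousLinearMap ((S.L2Left a).comp W.subtype)) : W)

/-- The projection lands in `W`. -/
theorem orthProjFun_mem (S : SurfaceShadow HX G) {W : Submodule ℂ HX} (hW : W ≤ S.H10 * S.H10)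
    [FiniteDimensional ℂ W] (a : HX) : S.orthProjFun hW a ∈ W :=
  Subtype.mem _

/-- THE DEFINING PROPERTY: `L2 x (orthProj a) = L2 x a` for every `x ∈ W`. -/
theorem L2_orthProjFun (S : SurfaceShadow HX G) {W : Submodule ℂ HX} (hW : W ≤ S.H10 * S.H10)
    [FiniteDimensional ℂ W] (a : HX) {x : HX} (hx : x ∈ W) :
    S.L2 x (S.orthProjFun hW a) = S.L2 x a := by
  letI := S.wNormed hW
  letI := S.wInner hW
  letI : CompleteSpace W := FiniteDimensional.complete ℂ W
  have h := @InnerProductSpace.toDual_symm_apply ℂ W _ _ _ _ ⟨x, hx⟩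
    (LinearMap.toContinuousLinearMap ((S.L2Left a).comp W.subtype))
  exact h

/-- Uniqueness: any `p ∈ W` with `L2 x p = L2 x a` for all `x ∈ W` is the projection. -/
theorem orthProjFun_eq_of (S : SurfaceShadow HX G) {W : Submodule ℂ HX} (hW : W ≤ S.H10 * S.H10)
    [FiniteDimensional ℂ W] (a : HX) {p : HX} (hp : p ∈ W) (h : ∀ x ∈ W, S.L2 x p = S.L2 x a) :
    S.orthProjFun hW a = p :=
  S.eq_of_L2_eq_on hW (S.orthProjFun_mem hW a) hp fun x hx => by
    rw [S.L2_orthProjFun hW a hx, h x hx]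

/-- The `L²`-orthogonal projection onto `W`, as a ℂ-linear map `H^*(X_∞) → H^*(X_∞)` with image in `W`. -/
def orthProj (S : SurfaceShadow HX G) {W : Submodule ℂ HX} (hW : W ≤ S.H10 * S.H10)
    [FiniteDimensional ℂ W] : HX →ₗ[ℂ] HX where
  toFun := S.orthProjFun hW
  map_add' a b := (S.orthProjFun_eq_of hW (a + b)
    (W.add_mem (S.orthProjFun_mem hW a) (S.orthProjFun_mem hW b)) fun x hx => by
      rw [S.L2_add_right, S.L2_orthProjFun hW a hx, S.L2_orthProjFun hW b hx, S.L2_add_right])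
  map_smul' c a := (S.orthProjFun_eq_of hW (c • a) (W.smul_mem c (S.orthProjFun_mem hW a))
    fun x hx => by rw [S.L2_smul_right, S.L2_orthProjFun hW a hx, S.L2_smul_right]; rfl)

/-- `orthProj a = orthProjFun a`. -/
@[simp] theorem orthProj_apply (S : SurfaceShadow HX G) {W : Submodule ℂ HX} (hW : W ≤ S.H10 * S.H10)
    [FiniteDimensional ℂ W] (a : HX) : S.orthProj hW a = S.orthProjFun hW a := rfl

/-- The projection lands in `W`. -/
theorem orthProj_mem (S : SurfaceShadow HX G) {W : Submodule ℂ HX} (hW : W ≤ S.H10 * S.H10)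
    [FiniteDimensional ℂ W] (a : HX) : S.orthProj hW a ∈ W :=
  S.orthProjFun_mem hW a

/-- THE DEFINING PROPERTY of the projection: `L2 x (orthProj a) = L2 x a` for `x ∈ W`. -/
theorem L2_orthProj (S : SurfaceShadow HX G) {W : Submodule ℂ HX} (hW : W ≤ S.H10 * S.H10)
    [FiniteDimensional ℂ W] (a : HX) {x : HX} (hx : x ∈ W) :
    S.L2 x (S.orthProj hW a) = S.L2 x a :=
  S.L2_orthProjFun hW a hx

/-- The projection is the identity on `W`. -/
theorem orthProj_of_mem (S : SurfaceShadow HX G) {W : Submodule ℂ HX} (hW : W ≤ S.H10 * S.H10)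
    [FiniteDimensional ℂ W] {a : HX} (ha : a ∈ W) : S.orthProj hW a = a :=
  S.orthProjFun_eq_of hW a ha fun _ _ => rfl

/-- The projection of `a` vanishes iff `a` is `L²`-orthogonal to `W`. -/
theorem orthProj_eq_zero_iff (S : SurfaceShadow HX G) {W : Submodule ℂ HX} (hW : W ≤ S.H10 * S.H10)
    [FiniteDimensional ℂ W] (a : HX) : S.orthProj hW a = 0 ↔ ∀ x ∈ W, S.L2 x a = 0 := by
  constructor
  · intro h x hx
    rw [← S.L2_orthProj hW a hx, h, S.L2_zero_right]
  · intro h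
    exact S.orthProjFun_eq_of hW a W.zero_mem fun x hx => by rw [S.L2_zero_right, h x hx]

/-- The projection is non-zero as soon as some `x ∈ W` pairs non-trivially with `a`. -/
theorem orthProj_ne_zero_of (S : SurfaceShadow HX G) {W : Submodule ℂ HX} (hW : W ≤ S.H10 * S.H10)
    [FiniteDimensional ℂ W] {a x : HX} (hx : x ∈ W) (h : S.L2 x a ≠ 0) : S.orthProj hW a ≠ 0 :=
  fun h0 => h (((S.orthProj_eq_zero_iff hW a).mp h0) x hx)

/-- `G`-EQUIVARIANCE: for `W` Hecke-stable, `orthProj (g • a) = g • orthProj a` (`L2_act` + uniqueness). -/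
theorem orthProj_act (S : SurfaceShadow HX G) {W : Submodule ℂ HX} (hW : W ≤ S.H10 * S.H10)
    [FiniteDimensional ℂ W] (hst : HeckeStable G W) (g : G) (a : HX) :
    S.orthProj hW (g • a) = g • S.orthProj hW a := by
  refine S.orthProjFun_eq_of hW (g • a) (hst g _ (S.orthProj_mem hW a)) fun x hx => ?_
  have hx' : g⁻¹ • x ∈ W := hst g⁻¹ x hx
  have e1 : x = g • (g⁻¹ • x) := (smul_inv_smul g x).symm
  calc S.L2 x (g • S.orthProj hW a)
      = S.L2 (g • (g⁻¹ • x)) (g • S.orthProj hW a) := by rw [← e1]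
    _ = S.L2 (g⁻¹ • x) (S.orthProj hW a) := S.L2_act g _ _
    _ = S.L2 (g⁻¹ • x) a := S.L2_orthProj hW a hx'
    _ = S.L2 (g • (g⁻¹ • x)) (g • a) := (S.L2_act g _ _).symm
    _ = S.L2 x (g • a) := by rw [← e1]

/-! ### 3. The consumer theorem: a non-orthogonal pair of Hecke-stable subspaces yields a non-zero
equivariant map between Hecke-irreducible constituents -/

/-- A linear functional that is non-zero somewhere on a Hecke-stable `U ≤ H^{1,0} ∧ H^{1,0}` is non-zero
on some vector of some Hecke-irreducible `W ≤ U` (`socle_eq_self` + `exists_ne_zero_of_mem_span`). -/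
theorem exists_irred_of_functional_ne_zero (S : SurfaceShadow HX G) {U : Submodule ℂ HX}
    (hU : U ≤ S.H10 * S.H10) (hst : HeckeStable G U) {σ : ℂ →+* ℂ} (φ : HX →ₛₗ[σ] ℂ) {a : HX}
    (ha : a ∈ U) (h : φ a ≠ 0) :
    ∃ W : Submodule ℂ HX, W ≤ U ∧ HeckeIrred G W ∧ ∃ w ∈ W, φ w ≠ 0 := by
  have hsoc : socle G U = U := socle_eq_self S hU hst
  have ha' : a ∈ Submodule.span ℂ
      (⋃ W : {W : Submodule ℂ HX // W ≤ U ∧ HeckeIrred G W}, ((W : Submodule ℂ HX) : Set HX)) := by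
    rw [Submodule.span_iUnion]
    simp only [Submodule.span_eq]
    show a ∈ socle G U
    rw [hsoc]; exact ha
  obtain ⟨w, hw, hφ⟩ := exists_ne_zero_of_mem_span φ ha' h
  obtain ⟨W, hwW⟩ := Set.mem_iUnion.mp hw
  exact ⟨W, W.2.1, W.2.2, w, hwW, hφ⟩

/-- THE CONSUMER THEOREM. `U, U' ≤ H^{1,0} ∧ H^{1,0}` Hecke-stable, `U'` finite-dimensional, `a ∈ U`,
`b ∈ U'` with `⟨a, b⟩ ≠ 0`: there are Hecke-irreducible `W ≤ U`, `W' ≤ U'` and a NON-ZERO `G`-equivariant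
ℂ-linear map `φ : W → H^*(X_∞)` with values in `W'` (the `L²`-projection onto `W'` restricted to `W`). -/
theorem exists_irred_equivariant_map (S : SurfaceShadow HX G) {U U' : Submodule ℂ HX}
    (hU : U ≤ S.H10 * S.H10) (hU' : U' ≤ S.H10 * S.H10) (hsU : HeckeStable G U)
    (hsU' : HeckeStable G U') [FiniteDimensional ℂ U'] {a b : HX} (ha : a ∈ U) (hb : b ∈ U')
    (h : S.L2 a b ≠ 0) :
    ∃ (W W' : Submodule ℂ HX) (hW : HeckeIrred G W), HeckeIrred G W' ∧ W ≤ U ∧ W' ≤ U' ∧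
      ∃ φ : W →ₗ[ℂ] HX, (∀ x : W, φ x ∈ W') ∧
        (∀ (g : G) (x : W), φ ⟨g • (x : HX), hW.2.1 g x x.2⟩ = g • φ x) ∧ φ ≠ 0 := by
  -- a vector `w` of an irreducible `W ≤ U` with `⟨w, b⟩ ≠ 0` (linear slot)
  obtain ⟨W, hWU, hWirr, w, hwW, hw⟩ :=
    S.exists_irred_of_functional_ne_zero hU hsU (S.L2Left b) ha h
  -- a vector `w'` of an irreducible `W' ≤ U'` with `⟨w, w'⟩ ≠ 0` (conjugate-linear slot)
  obtain ⟨W', hW'U', hW'irr, w', hw'W', hw'⟩ :=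
    S.exists_irred_of_functional_ne_zero hU' hsU' (S.L2Right w) hb hw
  haveI : FiniteDimensional ℂ W' := Submodule.finiteDimensional_of_le hW'U'
  have hW'le : W' ≤ S.H10 * S.H10 := hW'U'.trans hU'
  refine ⟨W, W', hWirr, hW'irr, hWU, hW'U', (S.orthProj hW'le).comp W.subtype, ?_, ?_, ?_⟩
  · intro x; exact S.orthProj_mem hW'le x
  · intro g x
    show S.orthProj hW'le (g • (x : HX)) = g • S.orthProj hW'le (x : HX)
    exact S.orthProj_act hW'le hW'irr.2.1 g x
  · intro hφ
    -- `⟨w', w⟩ ≠ 0` (conjugate symmetry), so the projection of `w` onto `W'` is non-zero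
    have hne : S.L2 w' w ≠ 0 := by
      rw [S.L2_conj_symm ((hWU.trans hU) hwW) (hW'le hw'W')]
      exact (map_ne_zero (starRingEnd ℂ)).mpr hw'
    have h0 : S.orthProj hW'le w ≠ 0 := S.orthProj_ne_zero_of hW'le hw'W' hne
    apply h0
    have := congrArg (fun ψ : W →ₗ[ℂ] HX => ψ ⟨w, hwW⟩) hφ
    simpa using this

/-! ### 4. Consequences of multiplicity one (H10) -/

/-- (H10) IN USE: two DISTINCT Hecke-irreducible subspaces of `H^{1,0} ∧ H^{1,0}`, the second
finite-dimensional, are `L²`-orthogonal (a non-orthogonal pair would give a non-zero equivariant map between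
them — the projection — and `H20_multone` would force them to coincide). -/
theorem L2_eq_zero_of_irred_ne (S : SurfaceShadow HX G) {W W' : Submodule ℂ HX}
    (hW : W ≤ S.H10 * S.H10) (hW' : W' ≤ S.H10 * S.H10) (hirr : HeckeIrred G W)
    (hirr' : HeckeIrred G W') [FiniteDimensional ℂ W'] (hne : W ≠ W') {w w' : HX} (hw : w ∈ W)
    (hw' : w' ∈ W') : S.L2 w w' = 0 := by
  by_contra h
  apply hne
  refine S.H20_multone W W' hW hW' hirr hirr' ((S.orthProj hW').comp W.subtype)
    (fun x => S.orthProj_mem hW' x) (fun g x => S.orthProj_act hW' hirr'.2.1 g x) ?_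
  intro hφ
  have hne' : S.L2 w' w ≠ 0 := by
    rw [S.L2_conj_symm (hW hw) (hW' hw')]
    exact (map_ne_zero (starRingEnd ℂ)).mpr h
  apply S.orthProj_ne_zero_of hW' hw' hne'
  have := congrArg (fun ψ : W →ₗ[ℂ] HX => ψ ⟨w, hw⟩) hφ
  simpa using this

/-- (H10) IN USE, projection form: for a finite-dimensional Hecke-irreducible `W` and a Hecke-stable
`U ≤ H^{1,0} ∧ H^{1,0}`, either `W ≤ U` or the projection onto `W` kills `U` (every irreducible constituent of
`U` is `≠ W`, hence orthogonal to `W`; `U` is the sup of its constituents by `socle_eq_self`). -/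
theorem orthProj_eq_zero_of_not_le (S : SurfaceShadow HX G) {W U : Submodule ℂ HX}
    (hW : W ≤ S.H10 * S.H10) (hirr : HeckeIrred G W) [FiniteDimensional ℂ W] (hU : U ≤ S.H10 * S.H10)
    (hst : HeckeStable G U) (hnle : ¬ W ≤ U) : ∀ a ∈ U, S.orthProj hW a = 0 := by
  intro a ha
  rw [S.orthProj_eq_zero_iff]
  intro x hx
  have hsoc : socle G U = U := socle_eq_self S hU hst
  rw [← hsoc] at ha
  unfold socle at ha
  refine Submodule.iSup_induction
    (fun W'' : {W'' : Submodule ℂ HX // W'' ≤ U ∧ HeckeIrred G W''} => (W'' : Submodule ℂ HX))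
    (motive := fun a => S.L2 x a = 0) ha ?_ ?_ ?_
  · rintro ⟨W'', hW''U, hW''irr⟩ b hb
    have hne : W'' ≠ W := fun h => hnle (h ▸ hW''U)
    have h0 : S.L2 b x = 0 :=
      S.L2_eq_zero_of_irred_ne (hW''U.trans hU) hW hW''irr hirr hne hb hx
    rw [S.L2_conj_symm ((hW''U.trans hU) hb) (hW hx), h0, map_zero]
  · exact S.L2_zero_right x
  · intro b c hb hc
    rw [S.L2_add_right, hb, hc, add_zero]

/-- The projection onto a finite-dimensional Hecke-irreducible `W ≤ U` restricted to a Hecke-stable `U`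
maps `U` into `W ≤ U`: together with `orthProj_eq_zero_of_not_le` this is the «preserves Hecke-stable
submodules» clause of the isotypic projections (the `comp_preserves` shape of Line 3). -/
theorem orthProj_mem_of_le (S : SurfaceShadow HX G) {W U : Submodule ℂ HX}
    (hW : W ≤ S.H10 * S.H10) [FiniteDimensional ℂ W] (hWU : W ≤ U) (a : HX) :
    S.orthProj hW a ∈ U :=
  hWU (S.orthProj_mem hW a)

end SurfaceShadow

end

end Summit.Ventures.HodgeRepro2.Tier7
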